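import Literature.AlgebraicGeometry.AbelianSchemes.PoincareFamilyPointsInjective
import Literature.AlgebraicGeometry.Morphisms.FormallyUnramifiedOfDualNumberRigid
import Mathlib.RingTheory.DualNumber
import HarnessLib

/-!
# The seesaw graph of the Poincaré family is formally unramified over the test scheme
# (Mumford, *Abelian Varieties* §13: «`Γ → T′` is unramified», from first-order rigidity of `𝒫` at every point)

Layer `Literature/AlgebraicGeometry/AbelianSchemes`, namespace `Literature.AlgebraicGeometry.AbelianSchemes`.  THEOREMS ONLY (no
definition, no named fact, no instance).  Sequel of ★ `AbelianSchemes/PoincareFamilyPointsInjective` (B-p07 (g20), p791848: §3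
`eq_of_nonempty_pullback_poincare_iso` «`(1 × g₁)^*𝒫 ≅ (1 × g₂)^*𝒫 ⇒ g₁ = g₂`» and §4 `firstOrderRigid_of_graphCond` «a `K[ε]`-point of
`T′ ×_S Â` with constant `T′`-coordinate and the graph condition has constant `Â`-coordinate») and of ★
`Morphisms/FormallyUnramifiedOfDualNumberRigid` (B-p08 (g15), p787816: a morphism locally of finite type all of whose `K[ε]`-points over
constant `K[ε]`-points are constant is formally unramified).

[MumfordAV1970] §13, proof of the Theorem (pp. 125–130): for `Â = A/K(L)` with its Poincaré family `𝒫` and a line bundle `ℒ` on `A × T′`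
(rigidified, fibrewise in `Pic⁰`), the SEESAW GRAPH `Γ ↪ T′ ×_S Â` — the closed subscheme whose `S`-points `u = (u₁, u₂)` are those with
`(1 × u₂)^*𝒫 ≅ (1 × u₁)^*ℒ` — is UNRAMIFIED over `T′`; this is the step «`Lie K(L) = 0` ⇒ the Kodaira–Spencer map of `𝒫` is injective»
read at every point.  Here:

* §1 (G1) `nonempty_graphIso_precomp` — graph points pull back along maps of test objects (apply `(1 × b)^*`; ★ `baseChangeToProd` ∕
  `Scheme.Modules.pullbackComp` bookkeeping);
* §2 **`formallyUnramified_fst_of_graph`** — for `i : Γ ⟶ T′ ⊗ Â` a closed immersion of `S`-schemes whose functor of points is the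
  graph condition (`hΓ`), `T′ → S` locally of finite type, `S` locally Noetherian, and the standing data of ★ §4 (`π : A → Â` a flat
  surjective homomorphism with kernel clause `hker` for `K(L)`, `𝒫` with socket `(1 × π)^*𝒫 ≅ Λ(L)`, `L` rank one rigidified along the zero
  section): `Γ → T′` is FORMALLY UNRAMIFIED.  Proof: `Γ → T′` is locally of finite type (`i` closed immersion, `pr_{T′}` a base change of
  the proper `Â → S`); a `K[ε]`-point `γ` of `Γ` over the constant point `str ≫ t` of `T′` is the pair `u = (str ≫ t, y_ε)` with the graph
  isomorphism (`hΓ`, forward); ★ §4 makes `y_ε = str ≫ y`; the graph isomorphism restricts along `Spec K → Spec K[ε]` (`ε ↦ 0`, (G1)) to one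
  for `(t, y)`; `hΓ` (backward) gives `v₀ : Spec K → Γ` with `v₀ ≫ i = (t, y)`, and `γ = str ≫ v₀` since both composites with the
  monomorphism `i` are `u`; conclude by ★ `FormallyUnramified.of_dualNumber_rigid`.

Port of the (Mc) lead's HOME closer `F3DualAbelianSchemeMcN3d.closer-v0` (B-p02 (g16), f069c3f8; cert aaec436a over the withdrawn (R))
re-pointed to ★ §4.  Cell hodgecm-mathlib (D-0151), F-3 (Mc) stub (N3d′) `stub_McN3d` of `Cruxes/HDel/Lines/F3DualAbelianSchemeMc.lean`
(v2 49bc8eda :151) closes BY NAME over this head (edition v2.1).  HC_CM is proved only modulo the 7 printed citations until rung 0 closes;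
this file discharges none of them.

## References
* [MumfordAV1970] D. Mumford, *Abelian Varieties* (1970), §13, proof of the Theorem (pp. 125–130).
* [EGAIV4] A. Grothendieck, *EGA IV₄* (1967), Prop. 17.4.1 and Cor. 17.4.2 (unramified ⟺ formally unramified + locally of finite type;
  the diagonal criterion).
* [GortzWedhorn2020] U. Görtz, T. Wedhorn, *Algebraic Geometry I*, 2nd ed. (2020), (6.4) and Prop. 6.7 (p. 152) (tangent spaces via
  `K[ε]`-points); Section (4.7) (pp. 107–108) (base change).
-/

noncomputable section

-- `TopCat.Presheaf`/`Scheme.Modules` are not reducible (as in ★ `PoincareFamilyPointsInjective`, ★ `AbelianSchemeKOfL`).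
set_option backward.isDefEq.respectTransparency false

open CategoryTheory CategoryTheory.Limits AlgebraicGeometry MonoidalCategory CartesianMonoidalCategory
open scoped MonObj DualNumber

namespace Literature.AlgebraicGeometry.AbelianSchemes

open Literature.AlgebraicGeometry.Motives Literature.AlgebraicGeometry.Modules

namespace AbelianSchemeOver

/-! ## §1 Graph points pull back along maps of test objects -/

section Glue

variable {S : Scheme.{0}} (A : AbelianSchemeOver S)

/-- (G0) `(1 × (u ≫ v)) = (1 × u) ≫ (1 × v)` on underlying maps. [cite: GortzWedhorn2020, Section (4.7) (pp. 107–108)] -/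
theorem whiskerLeft_comp_left_eq {U V W : Over S} (u : U ⟶ V) (v : V ⟶ W) :
    (A.X ◁ (u ≫ v)).left = (A.X ◁ u).left ≫ (A.X ◁ v).left := by
  rw [MonoidalCategory.whiskerLeft_comp, Over.comp_left]

/-- (G1) **Graph points pull back**: if `y` is a graph point for `x` over the test object `Y → S` (`(1 × y)^*𝒫 ≅ (1 × x)^*ℒ`) and
`b : Y₁ → Y` is a map of test objects over `S`, then `b ≫ y` is a graph point for `b ≫ x` (apply `(1 × b)^*`; the `(1 × y)` on the `𝒫`
side is ★ `baseChangeToProd`, rewritten as a whiskering by ★ `baseChangeToProd_eq_whiskerLeft_left`).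
[cite: MumfordAV1970, §13 (proof of the Thm., pp. 125–130)] [cite: GortzWedhorn2020, Section (4.7) (pp. 107–108)] -/
theorem nonempty_graphIso_precomp (hat : AbelianSchemeOver S) (P : (A.prodLeft hat).Modules) {T' : Over S}
    (ℒ : A.RigidifiedLineBundle T'.hom) {Y₁ Y : Scheme.{0}} {s₁ : Y₁ ⟶ S} {s : Y ⟶ S} (b : Over.mk s₁ ⟶ Over.mk s)
    (x : Over.mk s ⟶ T') (y : Over.mk s ⟶ hat.X)
    (e : Nonempty ((Scheme.Modules.pullback (A.baseChangeToProd hat s y.left (Over.w y))).obj P ≅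
      (Scheme.Modules.pullback (A.X ◁ x).left).obj ℒ.L)) :
    Nonempty ((Scheme.Modules.pullback (A.baseChangeToProd hat s₁ (b ≫ y).left (Over.w (b ≫ y)))).obj P ≅
      (Scheme.Modules.pullback (A.X ◁ (b ≫ x)).left).obj ℒ.L) := by
  obtain ⟨e⟩ := e
  have hb : A.baseChangeToProd hat s y.left (Over.w y) = (A.X ◁ y).left := A.baseChangeToProd_eq_whiskerLeft_left hat y
  have hbb : A.baseChangeToProd hat s₁ (b ≫ y).left (Over.w (b ≫ y)) = (A.X ◁ b).left ≫ (A.X ◁ y).left :=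
    (A.baseChangeToProd_eq_whiskerLeft_left hat (b ≫ y)).trans (A.whiskerLeft_comp_left_eq b y)
  have hx : (A.X ◁ b).left ≫ (A.X ◁ x).left = (A.X ◁ (b ≫ x)).left := (A.whiskerLeft_comp_left_eq b x).symm
  exact ⟨(Scheme.Modules.pullbackCongr hbb).app P ≪≫
    ((Scheme.Modules.pullbackComp (A.X ◁ b).left (A.X ◁ y).left).app P).symm ≪≫
    (Scheme.Modules.pullback (A.X ◁ b).left).mapIso ((Scheme.Modules.pullbackCongr hb.symm).app P ≪≫ e) ≪≫
    (Scheme.Modules.pullbackComp (A.X ◁ b).left (A.X ◁ x).left).app ℒ.L ≪≫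
    (Scheme.Modules.pullbackCongr hx).app ℒ.L⟩

end Glue

/-! ## §2 The seesaw graph is formally unramified over `T′` -/

section Unramified

variable {S : Scheme.{0}} [IsLocallyNoetherian S] (A hat : AbelianSchemeOver S) (π : A.X ⟶ hat.X) [IsMonHom π]
  [Flat π.left] [Surjective π.left]
  {L : A.left.Modules} (hL : HasRank L 1)
  (hε : CechPic.pullback A.unitSection (detClass (HasRank.isFiniteLocallyFree' hL)) = 1)
  (hker : ∀ (T : Over S) (u : T ⟶ A.X), u ≫ π = 1 ↔ A.MemKOfL L u)
  (P : (A.prodLeft hat).Modules)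
  (hsock : Nonempty ((Scheme.Modules.pullback (A.X ◁ π).left).obj P ≅ A.mumfordBundle L))

include hε hker hsock in
/-- **THE SEESAW GRAPH IS FORMALLY UNRAMIFIED OVER THE TEST SCHEME** ([MumfordAV1970] §13, proof of the Theorem: «`Γ → T′` is
unramified», the Kodaira–Spencer map of `𝒫` being injective at every point).  Data: the standing data of ★ `firstOrderRigid_of_graphCond`
(`Â = A/K(L)` presented by the flat surjective homomorphism `π` with kernel clause `hker`, the Poincaré family `𝒫 = P` with socket
`(1 × π)^*𝒫 ≅ Λ(L)`, `L` of rank one rigidified along the zero section); a test object `T′ → S` locally of finite type with a rigidified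
line bundle `ℒ` on `A × T′`; and a closed immersion of `S`-schemes `i : Γ ↪ T′ ×_S Â` whose functor of points is the GRAPH CONDITION
(`hΓ`: an `S`-morphism `u : Y → T′ ×_S Â` factors through `Γ` iff `(1 × u₂)^*𝒫 ≅ (1 × u₁)^*ℒ`).  Then `Γ → T′` is formally unramified
(★ `FormallyUnramified.of_dualNumber_rigid` + ★ §4 + (G1), see the module docstring).
[cite: MumfordAV1970, §13 (proof of the Thm., pp. 125–130)] [cite: EGAIV4, Prop. 17.4.1 and Cor. 17.4.2]
[cite: GortzWedhorn2020, (6.4) and Prop. 6.7 (p. 152)] -/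
theorem formallyUnramified_fst_of_graph (T' : Over S) [LocallyOfFiniteType T'.hom] (ℒ : A.RigidifiedLineBundle T'.hom)
    (Γ : Over S) (i : Γ ⟶ T' ⊗ hat.X) [IsClosedImmersion i.left]
    (hΓ : ∀ (Y : Over S) (u : Y ⟶ T' ⊗ hat.X), (∃ v : Y ⟶ Γ, v ≫ i = u) ↔
      Nonempty ((Scheme.Modules.pullback (A.baseChangeToProd hat Y.hom (u ≫ snd T' hat.X).left (Over.w (u ≫ snd T' hat.X)))).obj P ≅
        (Scheme.Modules.pullback (A.X ◁ (u ≫ fst T' hat.X)).left).obj ℒ.L)) :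
    FormallyUnramified (i ≫ fst T' hat.X).left := by
  classical
  -- `Γ → T′` is locally of finite type
  haveI := hat.isProper
  haveI : LocallyOfFiniteType hat.X.hom := inferInstance
  haveI : LocallyOfFiniteType (fst T' hat.X).left := (inferInstance : LocallyOfFiniteType (pullback.fst T'.hom hat.X.hom))
  haveI : LocallyOfFiniteType (i ≫ fst T' hat.X).left := (inferInstance : LocallyOfFiniteType (i.left ≫ (fst T' hat.X).left))
  refine Morphisms.FormallyUnramified.of_dualNumber_rigid _ fun K _ w t hw => ?_
  -- bookkeeping in `Over S`
  have hw' : w ≫ i.left ≫ (fst T' hat.X).left = Spec.map (CommRingCat.ofHom (algebraMap K K[ε])) ≫ t := by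
    simpa only [Over.comp_left, Category.assoc] using hw
  have hT : (T' ⊗ hat.X).hom = (fst T' hat.X).left ≫ T'.hom := (Over.w _).symm
  let u : Over.mk (Spec.map (CommRingCat.ofHom (algebraMap K K[ε])) ≫ t ≫ T'.hom) ⟶ T' ⊗ hat.X :=
    Over.homMk (w ≫ i.left) (by
      change (w ≫ i.left) ≫ (T' ⊗ hat.X).hom = Spec.map (CommRingCat.ofHom (algebraMap K K[ε])) ≫ t ≫ T'.hom
      rw [hT]
      simp only [Category.assoc]
      rw [reassoc_of% hw'])
  let v : Over.mk (Spec.map (CommRingCat.ofHom (algebraMap K K[ε])) ≫ t ≫ T'.hom) ⟶ Γ :=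
    Over.homMk w (by
      change w ≫ Γ.hom = Spec.map (CommRingCat.ofHom (algebraMap K K[ε])) ≫ t ≫ T'.hom
      rw [← Over.w i, hT, reassoc_of% hw'])
  have hvu : v ≫ i = u := Over.OverMorphism.ext rfl
  let strq : Over.mk (Spec.map (CommRingCat.ofHom (algebraMap K K[ε])) ≫ t ≫ T'.hom) ⟶ Over.mk (t ≫ T'.hom) :=
    Over.homMk (Spec.map (CommRingCat.ofHom (algebraMap K K[ε]))) rfl
  let tq : Over.mk (t ≫ T'.hom) ⟶ T' := Over.homMk t rfl
  have hu : u ≫ fst T' hat.X = strq ≫ tq := Over.OverMorphism.ext (by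
    change (w ≫ i.left) ≫ (fst T' hat.X).left = Spec.map (CommRingCat.ofHom (algebraMap K K[ε])) ≫ t
    rw [Category.assoc]
    exact hw')
  -- the graph isomorphism over `K[ε]` (functor of points of `Γ`, forward)
  have e : Nonempty ((Scheme.Modules.pullback (A.baseChangeToProd hat
      (Spec.map (CommRingCat.ofHom (algebraMap K K[ε])) ≫ t ≫ T'.hom)
      (u ≫ snd T' hat.X).left (Over.w (u ≫ snd T' hat.X)))).obj P ≅
      (Scheme.Modules.pullback (A.X ◁ (u ≫ fst T' hat.X)).left).obj ℒ.L) :=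
    (hΓ _ u).mp ⟨v, hvu⟩
  -- ★ §4: the `Â`-coordinate is constant
  obtain ⟨y, hy⟩ := A.firstOrderRigid_of_graphCond hat π hL hε hker P hsock T'.hom ℒ (t ≫ T'.hom) u tq hu e
  have hy' : u ≫ snd T' hat.X = strq ≫ y := hy
  -- restrict the graph isomorphism along the `K`-point `ε ↦ 0` of `Spec K[ε]`
  have hK : (TrivSqZeroExt.fstHom K K K).toRingHom.comp (algebraMap K K[ε]) = RingHom.id K :=
    RingHom.ext fun a => rfl
  have h0 : Spec.map (CommRingCat.ofHom (TrivSqZeroExt.fstHom K K K).toRingHom) ≫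
      Spec.map (CommRingCat.ofHom (algebraMap K K[ε])) = 𝟙 _ := by
    rw [← Spec.map_comp, ← CommRingCat.ofHom_comp, hK, CommRingCat.ofHom_id, Spec.map_id]
  let b₀ : Over.mk (t ≫ T'.hom) ⟶ Over.mk (Spec.map (CommRingCat.ofHom (algebraMap K K[ε])) ≫ t ≫ T'.hom) :=
    Over.homMk (Spec.map (CommRingCat.ofHom (TrivSqZeroExt.fstHom K K K).toRingHom)) (by
      change Spec.map (CommRingCat.ofHom (TrivSqZeroExt.fstHom K K K).toRingHom) ≫
        Spec.map (CommRingCat.ofHom (algebraMap K K[ε])) ≫ t ≫ T'.hom = t ≫ T'.hom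
      rw [reassoc_of% h0])
  have hb₀ : b₀ ≫ strq = 𝟙 _ := Over.OverMorphism.ext h0
  have hby : b₀ ≫ strq ≫ y = y := by rw [← Category.assoc, hb₀, Category.id_comp]
  have hbt : b₀ ≫ strq ≫ tq = tq := by rw [← Category.assoc, hb₀, Category.id_comp]
  rw [hu, hy'] at e
  have e₀ := A.nonempty_graphIso_precomp hat P ℒ b₀ (strq ≫ tq) (strq ≫ y) e
  rw [hby, hbt] at e₀
  -- the `K`-point of `Γ` (functor of points of `Γ`, backward)
  obtain ⟨v₀, hv₀⟩ := (hΓ (Over.mk (t ≫ T'.hom)) (lift tq y)).mpr (by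
    rw [lift_snd, lift_fst]
    exact e₀)
  refine ⟨v₀.left, ?_⟩
  -- `γ = str ≫ v₀`: both have image `u` under the monomorphism `i`
  have hu' : u = strq ≫ v₀ ≫ i := CartesianMonoidalCategory.hom_ext _ _
    (by rw [hu, Category.assoc, Category.assoc, reassoc_of% hv₀, lift_fst])
    (by rw [hy', Category.assoc, Category.assoc, reassoc_of% hv₀, lift_snd])
  have hl := congrArg (fun w => w.left) hu'
  change w ≫ i.left = Spec.map (CommRingCat.ofHom (algebraMap K K[ε])) ≫ v₀.left ≫ i.left at hl
  rw [← cancel_mono i.left, Category.assoc]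
  exact hl

end Unramified

end AbelianSchemeOver

end Literature.AlgebraicGeometry.AbelianSchemes

end
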